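import Mathlib

/-!
# The family wall `Σ_i |X_i||Y_i| ≤ dim J` — certificate proof

Route `LevelGradedCohnUmans`, crux `GradedDesignFamily` (stmt-MatrixMultiplication-7610), registered
stub `familyWall_card_le_finrank` (siege variation "certificate on the finite core").

The finite core is isolated as an explicit **rank certificate**: if a subspace `W ≤ R^α` contains
vectors `φ k` (`k : K`) and there are coordinates `p k : α` such that the evaluation matrix
`(φ k (p m))_{k,m}` is diagonal with non-zero diagonal, then `|K| ≤ dim W`
(`card_le_finrank_of_diagonal_certificate`).  For a right-translation-invariant `J ≤ ℂ^G` and a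
family `(X_i, Y_i, Z_i)_i` that is simultaneously `J`-separated in the crux's 0/1 pattern (all `Z_i`
non-empty), the certificate is: index set `K = Σ_i X_i × Y_i`, vectors
`φ_(i,x₀,y₀) = (g ↦ f_{i,x₀,z_i}(g · y₀⁻¹ z_i))` (right translates of the separators, one anchor
`z_i ∈ Z_i` per block), coordinates `p_(j,x,y) = x⁻¹ y`; the entry `φ_(i,x₀,y₀)(p_(j,x,y))` is the
separator value at the mixed quadruple product `x⁻¹ y y₀⁻¹ z_i`, which the separation pattern makes
`1` on the diagonal and `0` off it (cross-block entries vanish by simultaneity).  Hence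
`Σ_i |X_i||Y_i| = |K| ≤ dim J`.
[cite: CohnKleinbergSzegedyUmans2005, Def. 5.1]
-/

noncomputable section

set_option linter.dupNamespace false

open scoped BigOperators
open Module

namespace Summit.MatrixMultiplication.MatrixMultiplication.Theorems.GradedDesignFamily.WallCertificate

/-- **Diagonal rank certificate.**  If `W ≤ R^α` (with `α` finite) contains vectors `φ k`, `k : K`,
and there are coordinates `p k : α` at which the evaluation matrix `(φ k (p m))_{k,m}` is diagonal
with non-vanishing diagonal, then the `φ k` are linearly independent members of `W`, so
`|K| ≤ dim W`. [folklore] -/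
theorem card_le_finrank_of_diagonal_certificate {α K R : Type*} [Field R] [Finite α] [Fintype K]
    (W : Submodule R (α → R)) (φ : K → (α → R)) (hφ : ∀ k, φ k ∈ W) (p : K → α)
    (hdiag : ∀ k, φ k (p k) ≠ 0) (hoff : ∀ k m, k ≠ m → φ k (p m) = 0) :
    Fintype.card K ≤ finrank R W := by
  have hli : LinearIndependent R (fun k => (⟨φ k, hφ k⟩ : W)) := by
    refine LinearIndependent.of_comp W.subtype ?_
    rw [Fintype.linearIndependent_iff]
    intro c hc m
    have key := congr_fun hc (p m)
    rw [Finset.sum_apply, Finset.sum_eq_single m] at key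
    · simp only [Pi.smul_apply, Function.comp_apply, Submodule.coe_subtype, smul_eq_mul,
        Pi.zero_apply] at key
      exact (mul_eq_zero.mp key).resolve_right (hdiag m)
    · intro k _ hkm
      simp only [Pi.smul_apply, Function.comp_apply, Submodule.coe_subtype, smul_eq_mul,
        hoff k m hkm, mul_zero]
    · intro h
      exact absurd (Finset.mem_univ m) h
  exact hli.fintype_card_le_finrank

/-- **The family wall** (registered stub `familyWall_card_le_finrank` of crux
`GradedDesignFamily`, verbatim).  If `J ≤ ℂ^G` is right-translation invariant and the family
`(X_i, Y_i, Z_i)_{i : ι}` with all `Z_i` non-empty is simultaneously `J`-separated, then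
`Σ_i |X_i|·|Y_i| ≤ dim J`.  Proof: the diagonal rank certificate
`card_le_finrank_of_diagonal_certificate` with vectors the right translates
`g ↦ f_{i,x₀,z_i}(g · y₀⁻¹ z_i)` and coordinates `x⁻¹ y`.
[cite: CohnKleinbergSzegedyUmans2005, Def. 5.1] -/
theorem familyWall_card_le_finrank {G : Type} [Group G] [Fintype G] {ι : Type} [Fintype ι]
    [DecidableEq ι] (J : Submodule ℂ (G → ℂ)) (hJ : ∀ f ∈ J, ∀ u : G, (fun g : G => f (g * u)) ∈ J)
    (X Y Z : ι → Finset G) (hZ : ∀ i, (Z i).Nonempty)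
    (hsep : ∀ i : ι, ∀ x₀ ∈ X i, ∀ z₀ ∈ Z i, ∃ f ∈ J, ∀ a b : ι, ∀ x ∈ X a, ∀ y ∈ Y a, ∀ y' ∈ Y b,
      ∀ z ∈ Z b, ((a = i ∧ b = i ∧ x = x₀ ∧ y = y' ∧ z = z₀) → f (x⁻¹ * y * y'⁻¹ * z) = 1) ∧
        (¬ (a = i ∧ b = i ∧ x = x₀ ∧ y = y' ∧ z = z₀) → f (x⁻¹ * y * y'⁻¹ * z) = 0)) :
    ∑ i, (X i).card * (Y i).card ≤ finrank ℂ J := by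
  classical
  -- one right anchor `z i ∈ Z i` per block
  choose z hz using hZ
  -- the separators `f i x₀ _ z₀ _` of the family
  choose f hfJ hf using hsep
  -- separators anchored at `z i`, extended by `0` outside `X i` (a total function)
  obtain ⟨F, hFJ, hF⟩ : ∃ F : ι → G → (G → ℂ), (∀ i x₀, F i x₀ ∈ J) ∧
      ∀ i j x₀ x y y₀, x₀ ∈ X i → y₀ ∈ Y i → x ∈ X j → y ∈ Y j →
        F i x₀ (x⁻¹ * y * (y₀⁻¹ * z i)) = if j = i ∧ x = x₀ ∧ y = y₀ then 1 else 0 := by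
    refine ⟨fun i x₀ => if h : x₀ ∈ X i then f i x₀ h (z i) (hz i) else 0, ?_, ?_⟩
    · intro i x₀
      beta_reduce
      by_cases h : x₀ ∈ X i
      · rw [dif_pos h]
        exact hfJ i x₀ h (z i) (hz i)
      · rw [dif_neg h]
        exact J.zero_mem
    · intro i j x₀ x y y₀ hx₀ hy₀ hx hy
      beta_reduce
      rw [dif_pos hx₀]
      have hassoc : x⁻¹ * y * (y₀⁻¹ * z i) = x⁻¹ * y * y₀⁻¹ * z i := by group
      rw [hassoc]
      obtain ⟨h1, h0⟩ := hf i x₀ hx₀ (z i) (hz i) j i x hx y hy y₀ hy₀ (z i) (hz i)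
      by_cases hc : j = i ∧ x = x₀ ∧ y = y₀
      · rw [if_pos hc]
        exact h1 ⟨hc.1, rfl, hc.2.1, hc.2.2, rfl⟩
      · rw [if_neg hc]
        exact h0 fun h => hc ⟨h.1, h.2.2.1, h.2.2.2.1⟩
  -- the index set of the certificate: pairs `(x, y) ∈ X_i × Y_i` over all blocks
  let S : Finset (Σ _ : ι, G × G) := Finset.univ.sigma fun i => X i ×ˢ Y i
  -- the certificate: vectors `φ k ∈ J` and coordinates `p k ∈ G` with identity evaluation matrix
  obtain ⟨φ, p, hφ, hcert⟩ : ∃ (φ : S → (G → ℂ)) (p : S → G), (∀ k, φ k ∈ J) ∧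
      ∀ k m, φ k (p m) = if k = m then 1 else 0 := by
    refine ⟨fun k g => F k.1.1 k.1.2.1 (g * (k.1.2.2⁻¹ * z k.1.1)), fun k => k.1.2.1⁻¹ * k.1.2.2,
      fun k => hJ _ (hFJ _ _) _, ?_⟩
    rintro ⟨⟨i, x₀, y₀⟩, hk⟩ ⟨⟨j, x, y⟩, hm⟩
    obtain ⟨hx₀, hy₀⟩ := Finset.mem_product.mp (Finset.mem_sigma.mp hk).2
    obtain ⟨hx, hy⟩ := Finset.mem_product.mp (Finset.mem_sigma.mp hm).2
    show F i x₀ (x⁻¹ * y * (y₀⁻¹ * z i)) = _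
    rw [hF i j x₀ x y y₀ hx₀ hy₀ hx hy]
    by_cases hc : j = i ∧ x = x₀ ∧ y = y₀
    · obtain ⟨rfl, rfl, rfl⟩ := hc
      rw [if_pos ⟨rfl, rfl, rfl⟩, if_pos rfl]
    · have hne : (⟨⟨i, x₀, y₀⟩, hk⟩ : S) ≠ ⟨⟨j, x, y⟩, hm⟩ := by
        intro h
        have h' := congrArg Subtype.val h
        simp only [Sigma.mk.injEq, heq_eq_eq, Prod.mk.injEq] at h'
        obtain ⟨rfl, rfl, rfl⟩ := h'
        exact hc ⟨rfl, rfl, rfl⟩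
      rw [if_neg hc, if_neg hne]
  -- counting the index set
  have hcard : Fintype.card S = ∑ i, (X i).card * (Y i).card := by
    rw [Fintype.card_coe, Finset.card_sigma]
    exact Finset.sum_congr rfl fun i _ => Finset.card_product _ _
  calc ∑ i, (X i).card * (Y i).card = Fintype.card S := hcard.symm
    _ ≤ finrank ℂ J := card_le_finrank_of_diagonal_certificate J φ hφ p
        (fun k => by rw [hcert, if_pos rfl]; exact one_ne_zero)
        (fun k m hkm => by rw [hcert, if_neg hkm])

end Summit.MatrixMultiplication.MatrixMultiplication.Theorems.GradedDesignFamily.WallCertificate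

end
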